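import Mathlib
import Literature.Computability.Complexity.AlgebraicPCP
import HarnessLib

/-!
# An oracle proof system for algebraic constraint satisfaction over `Hᵐ`, II: soundness

Literature / complexity toolkit, seventh brick of the algebraic engine of probabilistically
checkable proofs for exponential-time computations: the **soundness** of the verifier of
`AlgebraicPCP.lean` (Babai–Fortnow–Lund 1991, §5–§7; Babai–Fortnow–Levin–Szegedy 1991, §5;
Arora–Barak 2009, §8.6.2 / §11.5.2), over a prime field `ZMod p`, as an exact count of accepting
tapes. For an UNSATISFIABLE, arbitrary proof `π = (Y, S)` and a threshold `θ` on the number of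
failing Rubinfeld–Sudan pairs with `(d+1)(2d+5) θ ≤ |Fᵐ|²`:

* if `Y` fails the low-degree test on `≥ θ` pairs, acceptance requires `T` passing tests:
  `#accept ≤ ((|Fᵐ|² - θ)/|Fᵐ|²)ᵀ · #tapes` (`card_accept_le_of_far`);
* otherwise `Y` is `2θ/|Fᵐ|²`-close to the decoding `g` of `LowDegreeTest.robust`, a polynomial
  of degree `≤ d` on every line (`linePoly_of_fwdDiff_eq_zero`), and an accepting tape either has a
  wrong self-corrected read (`≤ (d+1) · #{Y ≠ g}` directions per query, `card_selfCorrect_ne_le`),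
  or makes the sumcheck accept a wrong claim (`≤ K D / p`, `SumcheckF.card_accepts_mul_le`), or
  hits a zero of the nonzero extension `Ψ̂_λ` (`≤ K (#H-1) / p`, `card_lde_eq_zero_mul_le`), or
  has the powers of the seed `λ` annihilating the nonzero vector of constraint values at a
  violated index (`≤ (N-1)/p`, `card_powComb_eq_zero_le`: roots of a nonzero polynomial of degree
  `< N`) — since `g` does NOT satisfy the CSP (`card_accept_le_of_close`);
* **`soundness`**: altogether
  `#accept ≤ (((M² - θ)/M²)ᵀ + 2 Q (d+1) θ / M² + (K D + K (#H - 1) + (N - 1)) / p) · #tapes`,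
  `M = p^m`, `Q` the number of oracle reads of the final check, `N` the number of families.

The counting is organised by product decompositions of the tape space singling out one coordinate
(`eTests`, `eDir q`, `eR`, `eRho`, `eLam`) and the fiber bound `card_filter_mul_le_of_fiber`.

## References

* L. Babai, L. Fortnow, C. Lund, *Non-deterministic exponential time has two-prover interactive
  protocols*, Comput. Complexity 1 (1991), §5–§7 [BabaiFortnowLund1991].
* L. Babai, L. Fortnow, L. Levin, M. Szegedy, *Checking computations in polylogarithmic time*,
  STOC 1991, §5 [BFLS1991].
* S. Arora, B. Barak, *Computational Complexity: A Modern Approach*, CUP 2009, §8.6.2, §11.5.2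
  [AroraBarakCC2009].
-/

noncomputable section

open Finset Polynomial

namespace Literature.Computability.Complexity

namespace AlgebraicPCP

open LowDegreeExtension LowDegreeTest SumcheckF

/-! ### Generic counting: the fiber bound -/

/-- **The fiber bound.** If, along a product decomposition `τ ≃ X × R` of a finite type, every
fiber `{x | P(x, rest)}` satisfies `#fiber · μ ≤ c`, then `#{t | P t} · μ ≤ c · |R|`. [folklore] -/
theorem card_filter_mul_le_of_fiber {τ X R : Type*} [Fintype τ] [Fintype X] [Fintype R] (e : τ ≃ X × R)
    (P : τ → Prop) [DecidablePred P] {μ c : ℕ}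
    (h : ∀ rest : R, (univ.filter fun x : X => P (e.symm (x, rest))).card * μ ≤ c) :
    (univ.filter P).card * μ ≤ c * Fintype.card R := by
  classical
  have hcard : (univ.filter P).card = ((univ : Finset (X × R)).filter fun q => P (e.symm q)).card := by
    refine card_bij (fun t _ => e t) (fun t ht => ?_) (fun a _ b _ hab => e.injective hab) fun q hq => ?_
    · simpa using ht
    · exact ⟨e.symm q, by simpa using hq, by simp⟩
  rw [hcard, card_filter, ← univ_product_univ, sum_product, sum_comm, sum_mul]
  calc ∑ rest : R, (∑ x : X, if P (e.symm (x, rest)) then 1 else 0) * μ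
      = ∑ rest : R, (univ.filter fun x : X => P (e.symm (x, rest))).card * μ := by
        simp only [card_filter]
    _ ≤ ∑ _rest : R, c := sum_le_sum fun rest _ => h rest
    _ = c * Fintype.card R := by rw [sum_const, card_univ, smul_eq_mul, mul_comm]

/-- The fiber bound without multiplier. [folklore] -/
theorem card_filter_le_of_fiber {τ X R : Type*} [Fintype τ] [Fintype X] [Fintype R] (e : τ ≃ X × R)
    (P : τ → Prop) [DecidablePred P] {c : ℕ}
    (h : ∀ rest : R, (univ.filter fun x : X => P (e.symm (x, rest))).card ≤ c) :
    (univ.filter P).card ≤ c * Fintype.card R := by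
  have h' := card_filter_mul_le_of_fiber e P (μ := 1) (c := c) fun rest => by rw [mul_one]; exact h rest
  rwa [mul_one] at h'

/-! ### The tape space: product decompositions and cardinality -/

section TapeSpace

variable {F : Type*} [Field F] {K m : ℕ} (C : CSP F K m) (T : ℕ)

/-- The coordinates other than the low-degree tests. [folklore] -/
abbrev RestTests : Type _ := (Fin K → F) × F × (Fin K → F) × (C.Qry → Fin m → F)

/-- Singling out the low-degree tests. [folklore] -/
def eTests : Tape F C T ≃ (Fin T → (Fin m → F) × (Fin m → F)) × RestTests C where
  toFun τ := (τ.tests, τ.ρ, τ.seed, τ.r, τ.dirs)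
  invFun p := ⟨p.2.1, p.2.2.1, p.2.2.2.1, p.1, p.2.2.2.2⟩
  left_inv τ := by cases τ; rfl
  right_inv _ := rfl

/-- The coordinates other than the sumcheck challenges. [folklore] -/
abbrev RestR : Type _ := (Fin K → F) × F × (Fin T → (Fin m → F) × (Fin m → F)) × (C.Qry → Fin m → F)

/-- Singling out the sumcheck challenges. [folklore] -/
def eR : Tape F C T ≃ (Fin K → F) × RestR C T where
  toFun τ := (τ.r, τ.ρ, τ.seed, τ.tests, τ.dirs)
  invFun p := ⟨p.2.1, p.2.2.1, p.1, p.2.2.2.1, p.2.2.2.2⟩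
  left_inv τ := by cases τ; rfl
  right_inv _ := rfl

/-- The coordinates other than the point of the zero test. [folklore] -/
abbrev RestRho : Type _ := F × (Fin K → F) × (Fin T → (Fin m → F) × (Fin m → F)) × (C.Qry → Fin m → F)

/-- Singling out the point of the zero test. [folklore] -/
def eRho : Tape F C T ≃ (Fin K → F) × RestRho C T where
  toFun τ := (τ.ρ, τ.seed, τ.r, τ.tests, τ.dirs)
  invFun p := ⟨p.1, p.2.1, p.2.2.1, p.2.2.2.1, p.2.2.2.2⟩
  left_inv τ := by cases τ; rfl
  right_inv _ := rfl

/-- The coordinates other than the combination seed. [folklore] -/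
abbrev RestLam : Type _ := (Fin K → F) × (Fin K → F) × (Fin T → (Fin m → F) × (Fin m → F)) × (C.Qry → Fin m → F)

/-- Singling out the combination seed. [folklore] -/
def eLam : Tape F C T ≃ F × RestLam C T where
  toFun τ := (τ.seed, τ.ρ, τ.r, τ.tests, τ.dirs)
  invFun p := ⟨p.2.1, p.1, p.2.2.1, p.2.2.2.1, p.2.2.2.2⟩
  left_inv τ := by cases τ; rfl
  right_inv _ := rfl

/-- The coordinates other than one self-correction direction. [folklore] -/
abbrev RestDir (q : C.Qry) : Type _ :=
  (Fin K → F) × F × (Fin K → F) × (Fin T → (Fin m → F) × (Fin m → F)) × ({q' : C.Qry // q' ≠ q} → Fin m → F)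

/-- Singling out the self-correction direction of the query `q`. [folklore] -/
def eDir (q : C.Qry) : Tape F C T ≃ (Fin m → F) × RestDir C T q where
  toFun τ := (τ.dirs q, τ.ρ, τ.seed, τ.r, τ.tests, fun q' => τ.dirs q')
  invFun p := ⟨p.2.1, p.2.2.1, p.2.2.2.1, p.2.2.2.2.1, (Equiv.funSplitAt q (Fin m → F)).symm (p.1, p.2.2.2.2.2)⟩
  left_inv τ := by
    obtain ⟨ρ, lam, r, tests, dirs⟩ := τ
    simp only [Tape.mk.injEq, true_and]
    exact (Equiv.funSplitAt q (Fin m → F)).symm_apply_apply dirs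
  right_inv p := by
    obtain ⟨x, ρ, lam, r, tests, g⟩ := p
    have h := (Equiv.funSplitAt q (Fin m → F)).apply_symm_apply (x, g)
    simp only [Prod.mk.injEq, true_and]
    exact ⟨congrArg Prod.fst h, congrArg Prod.snd h⟩

/-- The direction singled out by `eDir` is read back. [folklore] -/
theorem eDir_symm_dirs (q : C.Qry) (x : Fin m → F) (rest : RestDir C T q) :
    ((eDir C T q).symm (x, rest)).dirs q = x := by
  show (Equiv.funSplitAt q (Fin m → F)).symm (x, rest.2.2.2.2) q = x
  simp [Equiv.funSplitAt_symm_apply]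

/-- The challenges are untouched by `eDir`. [folklore] -/
theorem eDir_symm_r (q : C.Qry) (x : Fin m → F) (rest : RestDir C T q) :
    ((eDir C T q).symm (x, rest)).r = rest.2.2.1 := rfl

variable [Fintype F]

/-- The tape space is finite (through the tests decomposition). [folklore] -/
instance : Fintype (Tape F C T) := Fintype.ofEquiv _ (eTests C T).symm

/-- Cardinality of the tape space through the tests. [folklore] -/
theorem card_tape_tests : Fintype.card (Tape F C T) =
    (Fintype.card (Fin m → F) * Fintype.card (Fin m → F)) ^ T * Fintype.card (RestTests C) := by
  rw [Fintype.card_congr (eTests C T), Fintype.card_prod, Fintype.card_fun, Fintype.card_prod, Fintype.card_fin]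

/-- Cardinality through the challenges. [folklore] -/
theorem card_tape_r : Fintype.card (Tape F C T) = Fintype.card F ^ K * Fintype.card (RestR C T) := by
  rw [Fintype.card_congr (eR C T), Fintype.card_prod, Fintype.card_fun, Fintype.card_fin]

/-- Cardinality through the zero-test point. [folklore] -/
theorem card_tape_rho : Fintype.card (Tape F C T) = Fintype.card F ^ K * Fintype.card (RestRho C T) := by
  rw [Fintype.card_congr (eRho C T), Fintype.card_prod, Fintype.card_fun, Fintype.card_fin]

/-- Cardinality through the combination seed. [folklore] -/
theorem card_tape_lam : Fintype.card (Tape F C T) = Fintype.card F * Fintype.card (RestLam C T) := by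
  rw [Fintype.card_congr (eLam C T), Fintype.card_prod]

omit [Fintype F] in
/-- **A nonzero power combination has few vanishing seeds**: if some `a_φ ≠ 0` then
`#{s | ∑_φ s^φ a_φ = 0} ≤ N - 1` (roots of a nonzero polynomial of degree `< N`).
[cite: AroraBarakCC2009, §11.5.2 (random weights), Lemma A.36] -/
theorem card_powComb_eq_zero_le [Fintype F] [DecidableEq F] {N : ℕ} (a : Fin N → F) (ha : ∃ i, a i ≠ 0) :
    (univ.filter fun s : F => ∑ i : Fin N, s ^ (i : ℕ) * a i = 0).card ≤ N - 1 := by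
  classical
  obtain ⟨i₀, hi₀⟩ := ha
  set Q : F[X] := ∑ i : Fin N, Polynomial.C (a i) * Polynomial.X ^ (i : ℕ) with hQ
  have hcoeff : ∀ n : Fin N, Q.coeff n = a n := by
    intro n
    rw [hQ, Polynomial.finsetSum_coeff]
    simp only [Polynomial.coeff_C_mul_X_pow]
    rw [Finset.sum_eq_single n (fun b _ hb => if_neg fun h => hb (Fin.ext h.symm)) (by simp)]
    simp
  have hQne : Q ≠ 0 := fun h => hi₀ (by rw [← hcoeff i₀, h, Polynomial.coeff_zero])
  have hdeg : Q.natDegree ≤ N - 1 := by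
    rw [hQ]
    refine Polynomial.natDegree_sum_le_of_forall_le _ _ fun i _ => ?_
    refine (Polynomial.natDegree_C_mul_le _ _).trans ((Polynomial.natDegree_pow_le).trans ?_)
    have := i.2
    calc (i : ℕ) * Polynomial.X.natDegree ≤ (i : ℕ) * 1 := Nat.mul_le_mul_left _ Polynomial.natDegree_X_le
      _ ≤ N - 1 := by omega
  have heval : ∀ s : F, Q.eval s = ∑ i : Fin N, s ^ (i : ℕ) * a i := by
    intro s
    rw [hQ, Polynomial.eval_finsetSum]
    refine sum_congr rfl fun i _ => ?_
    rw [Polynomial.eval_mul, Polynomial.eval_C, Polynomial.eval_pow, Polynomial.eval_X, mul_comm]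
  calc (univ.filter fun s : F => ∑ i : Fin N, s ^ (i : ℕ) * a i = 0).card ≤ Q.roots.toFinset.card := by
        refine card_le_card fun s hs => ?_
        rw [Multiset.mem_toFinset, Polynomial.mem_roots hQne, Polynomial.IsRoot.def, heval]
        exact (mem_filter.1 hs).2
    _ ≤ Multiset.card Q.roots := Multiset.toFinset_card_le _
    _ ≤ Q.natDegree := Polynomial.card_roots' Q
    _ ≤ N - 1 := hdeg

/-- Cardinality through one direction. [folklore] -/
theorem card_tape_dir (q : C.Qry) : Fintype.card (Tape F C T) = Fintype.card (Fin m → F) * Fintype.card (RestDir C T q) := by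
  rw [Fintype.card_congr (eDir C T q), Fintype.card_prod]

end TapeSpace

/-! ### Soundness over a prime field -/

section Soundness

variable {p : ℕ} [Fact p.Prime] {K m : ℕ} (H : Finset (ZMod p)) (prm : Params) (C : CSP (ZMod p) K m)

local notation "𝔽" => ZMod p

open scoped Classical in
/-- **Far oracles: acceptance needs `T` passing low-degree tests.** If `Y` fails the
Rubinfeld–Sudan test on at least `θ` pairs then
`#accept · (M²)ᵀ ≤ (M² - θ)ᵀ · #tapes`, `M = |Fᵐ|`. [cite: RubinfeldSudan1996, §4] -/
theorem card_accept_le_of_far (π : Proof 𝔽 K m C.N) {θ : ℕ}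
    (hfar : θ ≤ (fails (diffCoeff prm.d) prm.d π.Y).card) :
    (univ.filter fun τ : Tape 𝔽 C prm.T => Accept H prm C π τ).card *
        (Fintype.card (Fin m → 𝔽) * Fintype.card (Fin m → 𝔽)) ^ prm.T ≤
      (Fintype.card (Fin m → 𝔽) * Fintype.card (Fin m → 𝔽) - θ) ^ prm.T * Fintype.card (Tape 𝔽 C prm.T) := by
  classical
  set M2 := Fintype.card (Fin m → 𝔽) * Fintype.card (Fin m → 𝔽) with hM2
  -- the passing pairs
  set G : Finset ((Fin m → 𝔽) × (Fin m → 𝔽)) := univ.filter fun q => testSum (diffCoeff prm.d) prm.d π.Y q.1 q.2 = 0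
    with hG
  have hGcard : G.card + (fails (diffCoeff prm.d) prm.d π.Y).card = M2 := by
    rw [hG, fails, hM2, ← Fintype.card_prod, ← card_univ]
    convert card_filter_add_card_filter_not (s := (univ : Finset ((Fin m → 𝔽) × (Fin m → 𝔽))))
      (fun q => testSum (diffCoeff prm.d) prm.d π.Y q.1 q.2 = 0) using 3
  have hGle : G.card ≤ M2 - θ := by omega
  -- acceptance implies passing all tests
  have hsub : (univ.filter fun τ : Tape 𝔽 C prm.T => Accept H prm C π τ).card ≤
      (univ.filter fun τ : Tape 𝔽 C prm.T => passRS prm C π τ).card :=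
    card_le_card (fun τ hτ => mem_filter.2 ⟨mem_univ _, (mem_filter.1 hτ).2.rs⟩)
  -- count the passing tapes along `eTests`
  have hpass : (univ.filter fun τ : Tape 𝔽 C prm.T => passRS prm C π τ).card ≤
      G.card ^ prm.T * Fintype.card (RestTests C) := by
    refine card_filter_le_of_fiber (eTests C prm.T) _ fun rest => ?_
    have : (univ.filter fun x : Fin prm.T → (Fin m → 𝔽) × (Fin m → 𝔽) => passRS prm C π ((eTests C prm.T).symm (x, rest))) =
        Fintype.piFinset fun _ : Fin prm.T => G := by
      ext x
      simp only [mem_filter, mem_univ, true_and, Fintype.mem_piFinset, hG, passRS_iff]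
      rfl
    rw [this, Fintype.card_piFinset_const]
  calc (univ.filter fun τ : Tape 𝔽 C prm.T => Accept H prm C π τ).card * M2 ^ prm.T
      ≤ G.card ^ prm.T * Fintype.card (RestTests C) * M2 ^ prm.T := Nat.mul_le_mul_right _ (hsub.trans hpass)
    _ ≤ (M2 - θ) ^ prm.T * Fintype.card (RestTests C) * M2 ^ prm.T :=
        Nat.mul_le_mul_right _ (Nat.mul_le_mul_right _ (Nat.pow_le_pow_left hGle _))
    _ = (M2 - θ) ^ prm.T * Fintype.card (Tape 𝔽 C prm.T) := by
        rw [card_tape_tests, ← hM2]; ring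

/-- **Wrong self-corrected reads are rare**: for a query `q` and any `g` that is a polynomial of
degree `≤ d` on every line, `#{τ | read q ≠ g(address)} · M ≤ (d+1) · #{Y ≠ g} · #tapes`.
[cite: AroraBarakCC2009, §8.6.2] -/
theorem card_badSC_mul_le (π : Proof 𝔽 K m C.N) {g : (Fin m → 𝔽) → 𝔽} (hg : LinePoly g prm.d)
    (hunit : ∀ i : ℕ, 1 ≤ i → i ≤ prm.d + 1 → (i : 𝔽) ≠ 0) (q : C.Qry) :
    (univ.filter fun τ : Tape 𝔽 C prm.T => scVal prm C π τ q ≠ g (readAddr ((C.fam q.1).addr q.2) τ.r)).card *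
        Fintype.card (Fin m → 𝔽) ≤
      (prm.d + 1) * (univ.filter fun x : Fin m → 𝔽 => π.Y x ≠ g x).card * Fintype.card (Tape 𝔽 C prm.T) := by
  classical
  have h := card_filter_le_of_fiber (eDir C prm.T q)
    (fun τ : Tape 𝔽 C prm.T => scVal prm C π τ q ≠ g (readAddr ((C.fam q.1).addr q.2) τ.r))
    (c := (prm.d + 1) * (univ.filter fun x : Fin m → 𝔽 => π.Y x ≠ g x).card) fun rest => by
      have hr : ∀ x : Fin m → 𝔽, ((eDir C prm.T q).symm (x, rest)).r = rest.2.2.1 := fun x => rfl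
      have hx : ∀ x : Fin m → 𝔽, ((eDir C prm.T q).symm (x, rest)).dirs q = x := fun x => eDir_symm_dirs C prm.T q x rest
      have heq : (univ.filter fun x : Fin m → 𝔽 =>
          scVal prm C π ((eDir C prm.T q).symm (x, rest)) q ≠ g (readAddr ((C.fam q.1).addr q.2) ((eDir C prm.T q).symm (x, rest)).r)) =
          univ.filter fun x : Fin m → 𝔽 =>
            selfCorrect prm.d π.Y (readAddr ((C.fam q.1).addr q.2) rest.2.2.1) x ≠ g (readAddr ((C.fam q.1).addr q.2) rest.2.2.1) := by
        refine filter_congr fun x _ => ?_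
        simp only [scVal, hr, hx]
      rw [heq]
      exact card_selfCorrect_ne_le hunit π.Y hg _
  calc _ ≤ (prm.d + 1) * (univ.filter fun x : Fin m → 𝔽 => π.Y x ≠ g x).card * Fintype.card (RestDir C prm.T q) *
        Fintype.card (Fin m → 𝔽) := Nat.mul_le_mul_right _ h
    _ = _ := by rw [card_tape_dir C prm.T q]; ring

open scoped Classical in
/-- **Close oracles.** If `Y` is `2θ/M²`-close (in the count form `#{Y ≠ g} · M ≤ 2θ`) to some `g`
that is a polynomial of degree `≤ d` on every line and the CSP is UNSATISFIABLE, then the accepting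
tapes are few: wrong reads, wrong sumcheck claims accepted, zeros of the nonzero extension, or
annihilating combinations. [cite: BabaiFortnowLund1991, §5–§7] [cite: AroraBarakCC2009, §8.6.2 and §11.5.2] -/
theorem card_accept_le_of_close (hC : ¬ C.Satisfiable H) (π : Proof 𝔽 K m C.N) {g : (Fin m → 𝔽) → 𝔽}
    (hg : LinePoly g prm.d) (hd1 : 1 ≤ prm.d) (hD : C.maxDeg * prm.d + (H.card - 1) ≤ prm.D)
    (hunit : ∀ i : ℕ, 1 ≤ i → i ≤ prm.d + 1 → (i : 𝔽) ≠ 0) {θ : ℕ}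
    (hclose : (univ.filter fun x : Fin m → 𝔽 => π.Y x ≠ g x).card * Fintype.card (Fin m → 𝔽) ≤ 2 * θ) :
    ((univ.filter fun τ : Tape 𝔽 C prm.T => Accept H prm C π τ).card : ℝ) ≤
      (((2 * Fintype.card C.Qry * (prm.d + 1) * θ : ℕ) : ℝ) / ((Fintype.card (Fin m → 𝔽) : ℝ) * Fintype.card (Fin m → 𝔽)) +
        ((K * prm.D + K * (H.card - 1) + (C.N - 1) : ℕ) : ℝ) / p) * Fintype.card (Tape 𝔽 C prm.T) := by
  classical
  set N := Fintype.card (Tape 𝔽 C prm.T) with hN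
  set M := Fintype.card (Fin m → 𝔽) with hM
  have hp : Fintype.card 𝔽 = p := ZMod.card p
  have hMpos : 0 < M := Fintype.card_pos
  have hppos : (0 : ℝ) < p := by exact_mod_cast (Fact.out : p.Prime).pos
  -- the events
  set Eacc := univ.filter fun τ : Tape 𝔽 C prm.T => Accept H prm C π τ with hEacc
  set Esc := univ.filter fun τ : Tape 𝔽 C prm.T => ¬ GoodSC (prm := prm) π τ g with hEsc
  set E1 := univ.filter fun τ : Tape 𝔽 C prm.T =>
    Accepts H (Φ H C g τ.ρ τ.lam) K prm.D 0 (msgs prm C π τ) (List.ofFn τ.r) ∧ psum H (Φ H C g τ.ρ τ.lam) K [] ≠ 0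
    with hE1
  set E2a := univ.filter fun τ : Tape 𝔽 C prm.T =>
    (∃ c : Fin K → 𝔽, (∀ t, c t ∈ H) ∧ Ψ C g τ.lam c ≠ 0) ∧ lde H (Ψ C g τ.lam) τ.ρ = 0 with hE2a
  set E2b := univ.filter fun τ : Tape 𝔽 C prm.T => ∀ c : Fin K → 𝔽, (∀ t, c t ∈ H) → Ψ C g τ.lam c = 0 with hE2b
  -- the cover
  have hcover : Eacc ⊆ Esc ∪ E1 ∪ E2a ∪ E2b := by
    intro τ hτ
    have hacc := (mem_filter.1 hτ).2
    simp only [mem_union, mem_filter, mem_univ, true_and, hEsc, hE1, hE2a, hE2b]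
    by_cases hsc : GoodSC (prm := prm) π τ g
    · have hA := accepts_of_goodSC hacc hsc
      by_cases hps : psum H (Φ H C g τ.ρ τ.lam) K [] = 0
      · rw [psum_Φ] at hps
        by_cases hex : ∃ c : Fin K → 𝔽, (∀ t, c t ∈ H) ∧ Ψ C g τ.lam c ≠ 0
        · exact Or.inl (Or.inr ⟨hex, hps⟩)
        · refine Or.inr fun c hc => ?_
          by_contra hne
          exact hex ⟨c, hc, hne⟩
      · exact Or.inl (Or.inl (Or.inr ⟨hA, hps⟩))
    · exact Or.inl (Or.inl (Or.inl hsc))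
  -- (1) wrong self-corrected reads
  have hBad : (univ.filter fun x : Fin m → 𝔽 => π.Y x ≠ g x).card * M ≤ 2 * θ := hclose
  have hEsc : Esc.card * M * M ≤ Fintype.card C.Qry * ((prm.d + 1) * (2 * θ)) * N := by
    have hsub : Esc ⊆ (univ : Finset C.Qry).biUnion fun q => univ.filter fun τ : Tape 𝔽 C prm.T =>
        scVal prm C π τ q ≠ g (readAddr ((C.fam q.1).addr q.2) τ.r) := by
      intro τ hτ
      have hτ' : ¬ GoodSC (prm := prm) π τ g := (mem_filter.1 hτ).2
      rw [goodSC_iff] at hτ'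
      push Not at hτ'
      obtain ⟨q, hq⟩ := hτ'
      exact mem_biUnion.2 ⟨q, mem_univ _, mem_filter.2 ⟨mem_univ _, hq⟩⟩
    have hq : ∀ q : C.Qry, (univ.filter fun τ : Tape 𝔽 C prm.T =>
        scVal prm C π τ q ≠ g (readAddr ((C.fam q.1).addr q.2) τ.r)).card * M * M ≤ (prm.d + 1) * (2 * θ) * N := by
      intro q
      have h1 := card_badSC_mul_le prm C π hg hunit q
      rw [← hM, ← hN] at h1
      calc _ ≤ (prm.d + 1) * (univ.filter fun x : Fin m → 𝔽 => π.Y x ≠ g x).card * N * M := Nat.mul_le_mul_right _ h1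
        _ = (prm.d + 1) * ((univ.filter fun x : Fin m → 𝔽 => π.Y x ≠ g x).card * M) * N := by ring
        _ ≤ (prm.d + 1) * (2 * θ) * N := Nat.mul_le_mul_right _ (Nat.mul_le_mul_left _ hBad)
    calc Esc.card * M * M ≤ ((univ : Finset C.Qry).biUnion fun q => univ.filter fun τ : Tape 𝔽 C prm.T =>
          scVal prm C π τ q ≠ g (readAddr ((C.fam q.1).addr q.2) τ.r)).card * M * M :=
          Nat.mul_le_mul_right _ (Nat.mul_le_mul_right _ (card_le_card hsub))
      _ ≤ (∑ q : C.Qry, (univ.filter fun τ : Tape 𝔽 C prm.T =>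
          scVal prm C π τ q ≠ g (readAddr ((C.fam q.1).addr q.2) τ.r)).card) * M * M :=
          Nat.mul_le_mul_right _ (Nat.mul_le_mul_right _ card_biUnion_le)
      _ = ∑ q : C.Qry, (univ.filter fun τ : Tape 𝔽 C prm.T =>
          scVal prm C π τ q ≠ g (readAddr ((C.fam q.1).addr q.2) τ.r)).card * M * M := by rw [sum_mul, sum_mul]
      _ ≤ ∑ _q : C.Qry, (prm.d + 1) * (2 * θ) * N := sum_le_sum fun q _ => hq q
      _ = Fintype.card C.Qry * ((prm.d + 1) * (2 * θ)) * N := by rw [sum_const, card_univ, smul_eq_mul]; ring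
  -- (2) the sumcheck accepts a wrong claim
  have hΦD : ∀ (ρ : Fin K → 𝔽) (lam : Fin C.N → 𝔽), AxisPoly (Φ H C g ρ lam) K prm.D :=
    fun ρ lam => (axisPoly_Φ hg hd1 ρ lam).mono hD
  have hE1 : E1.card * p ≤ K * prm.D * N := by
    have h := card_filter_mul_le_of_fiber (eR C prm.T) (fun τ : Tape 𝔽 C prm.T =>
        Accepts H (Φ H C g τ.ρ τ.lam) K prm.D 0 (msgs prm C π τ) (List.ofFn τ.r) ∧ psum H (Φ H C g τ.ρ τ.lam) K [] ≠ 0)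
      (μ := p) (c := K * prm.D * p ^ K) fun rest => by
        by_cases hv : psum H (Φ H C g rest.1 fun φ : Fin C.N => rest.2.1 ^ (φ : ℕ)) K [] = 0
        · have : (univ.filter fun r : Fin K → 𝔽 =>
              Accepts H (Φ H C g ((eR C prm.T).symm (r, rest)).ρ ((eR C prm.T).symm (r, rest)).lam) K prm.D 0
                (msgs prm C π ((eR C prm.T).symm (r, rest))) (List.ofFn ((eR C prm.T).symm (r, rest)).r) ∧
              psum H (Φ H C g ((eR C prm.T).symm (r, rest)).ρ ((eR C prm.T).symm (r, rest)).lam) K [] ≠ 0) = ∅ := by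
            refine filter_eq_empty_iff.2 fun r _ h => h.2 ?_
            exact hv
          rw [this, card_empty, zero_mul]
          exact Nat.zero_le _
        · have hcnt := card_accepts_mul_le (H := H) (hΦD rest.1 fun φ : Fin C.N => rest.2.1 ^ (φ : ℕ)) (v := 0) hv
            (π.S rest.1 rest.2.1)
          rw [hp] at hcnt
          refine le_trans (Nat.mul_le_mul_right _ (card_le_card fun r hr => ?_)) hcnt
          rw [mem_filter] at hr ⊢
          exact ⟨mem_univ _, hr.2.1⟩
    calc E1.card * p ≤ K * prm.D * p ^ K * Fintype.card (RestR C prm.T) := h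
      _ = K * prm.D * N := by rw [hN, card_tape_r, hp]; ring
  -- (3) zeros of the nonzero extension
  have hE2a : E2a.card * p ≤ K * (H.card - 1) * N := by
    have h := card_filter_mul_le_of_fiber (eRho C prm.T) (fun τ : Tape 𝔽 C prm.T =>
        (∃ c : Fin K → 𝔽, (∀ t, c t ∈ H) ∧ Ψ C g τ.lam c ≠ 0) ∧ lde H (Ψ C g τ.lam) τ.ρ = 0)
      (μ := p) (c := K * (H.card - 1) * p ^ K) fun rest => by
        by_cases hex : ∃ c : Fin K → 𝔽, (∀ t, c t ∈ H) ∧ Ψ C g (fun φ : Fin C.N => rest.1 ^ (φ : ℕ)) c ≠ 0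
        · obtain ⟨c₀, hc₀, hne⟩ := hex
          have hcnt := card_lde_eq_zero_mul_le (H := H) (Ψ C g fun φ : Fin C.N => rest.1 ^ (φ : ℕ)) hc₀ hne
          rw [hp] at hcnt
          refine le_trans (Nat.mul_le_mul_right _ (card_le_card fun ρ hρ => ?_)) hcnt
          rw [mem_filter] at hρ ⊢
          exact ⟨mem_univ _, hρ.2.2⟩
        · have : (univ.filter fun ρ : Fin K → 𝔽 =>
              (∃ c : Fin K → 𝔽, (∀ t, c t ∈ H) ∧ Ψ C g ((eRho C prm.T).symm (ρ, rest)).lam c ≠ 0) ∧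
                lde H (Ψ C g ((eRho C prm.T).symm (ρ, rest)).lam) ((eRho C prm.T).symm (ρ, rest)).ρ = 0) = ∅ :=
            filter_eq_empty_iff.2 fun ρ _ h => hex h.1
          rw [this, card_empty, zero_mul]
          exact Nat.zero_le _
    calc E2a.card * p ≤ K * (H.card - 1) * p ^ K * Fintype.card (RestRho C prm.T) := h
      _ = K * (H.card - 1) * N := by rw [hN, card_tape_rho, hp]; ring
  -- (4) `g` violates some constraint: annihilating combinations
  obtain ⟨φ₀, z₀, hz₀, hne⟩ : ∃ (φ₀ : Fin C.N) (z₀ : Fin K → 𝔽), (∀ t, z₀ t ∈ H) ∧ (C.fam φ₀).eval g z₀ ≠ 0 := by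
    by_contra hall
    push Not at hall
    exact hC ⟨g, ⟨fun φ z hz => hall φ z hz⟩⟩
  have hE2b : E2b.card * p ≤ (C.N - 1) * N := by
    have h := card_filter_mul_le_of_fiber (eLam C prm.T) (fun τ : Tape 𝔽 C prm.T =>
        ∀ c : Fin K → 𝔽, (∀ t, c t ∈ H) → Ψ C g τ.lam c = 0) (μ := p) (c := (C.N - 1) * p) fun rest => by
      have hcnt := card_powComb_eq_zero_le (fun φ => (C.fam φ).eval g z₀) ⟨φ₀, hne⟩
      refine Nat.mul_le_mul_right _ (le_trans (card_le_card fun s hs => ?_) hcnt)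
      rw [mem_filter] at hs ⊢
      refine ⟨mem_univ _, ?_⟩
      have h0 := hs.2 z₀ hz₀
      unfold Ψ Tape.lam at h0
      exact h0
    calc E2b.card * p ≤ (C.N - 1) * p * Fintype.card (RestLam C prm.T) := h
      _ = (C.N - 1) * N := by rw [hN, card_tape_lam, hp]; ring
  -- assembling, in `ℝ`
  have hunion : Eacc.card ≤ Esc.card + E1.card + E2a.card + E2b.card :=
    (card_le_card hcover).trans ((card_union_le _ _).trans (Nat.add_le_add_right
      ((card_union_le _ _).trans (Nat.add_le_add_right (card_union_le _ _) _)) _))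
  have hMM : (0 : ℝ) < (M : ℝ) * M := by positivity
  have r1 : (Esc.card : ℝ) ≤ ((2 * Fintype.card C.Qry * (prm.d + 1) * θ : ℕ) : ℝ) / ((M : ℝ) * M) * N := by
    rw [div_mul_eq_mul_div, le_div_iff₀ hMM]
    have : (Esc.card : ℝ) * (M * M) = ((Esc.card * M * M : ℕ) : ℝ) := by push_cast; ring
    rw [this]
    have h' : ((Esc.card * M * M : ℕ) : ℝ) ≤ ((Fintype.card C.Qry * ((prm.d + 1) * (2 * θ)) * N : ℕ) : ℝ) := by
      exact_mod_cast hEsc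
    refine h'.trans (le_of_eq ?_)
    push_cast
    ring
  have r2 : (E1.card : ℝ) + E2a.card + E2b.card ≤ ((K * prm.D + K * (H.card - 1) + (C.N - 1) : ℕ) : ℝ) / p * N := by
    rw [div_mul_eq_mul_div, le_div_iff₀ hppos]
    have h' : ((E1.card * p + E2a.card * p + E2b.card * p : ℕ) : ℝ) ≤
        (((K * prm.D + K * (H.card - 1) + (C.N - 1)) * N : ℕ) : ℝ) := by
      have : E1.card * p + E2a.card * p + E2b.card * p ≤ (K * prm.D + K * (H.card - 1) + (C.N - 1)) * N := by
        calc E1.card * p + E2a.card * p + E2b.card * p ≤ K * prm.D * N + K * (H.card - 1) * N + (C.N - 1) * N :=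
            Nat.add_le_add (Nat.add_le_add hE1 hE2a) hE2b
          _ = (K * prm.D + K * (H.card - 1) + (C.N - 1)) * N := by ring
      exact_mod_cast this
    have e1 : ((E1.card : ℝ) + E2a.card + E2b.card) * p = ((E1.card * p + E2a.card * p + E2b.card * p : ℕ) : ℝ) := by
      push_cast; ring
    rw [e1]
    refine h'.trans (le_of_eq ?_)
    push_cast
    ring
  calc (Eacc.card : ℝ) ≤ ((Esc.card + E1.card + E2a.card + E2b.card : ℕ) : ℝ) := by exact_mod_cast hunion
    _ = (Esc.card : ℝ) + (E1.card + E2a.card + E2b.card) := by push_cast; ring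
    _ ≤ ((2 * Fintype.card C.Qry * (prm.d + 1) * θ : ℕ) : ℝ) / ((M : ℝ) * M) * N +
        ((K * prm.D + K * (H.card - 1) + (C.N - 1) : ℕ) : ℝ) / p * N := add_le_add r1 r2
    _ = _ := by ring

open scoped Classical in
/-- **Soundness of the proof system** (Babai–Fortnow–Lund / BFLS verifier for an algebraic CSP
over `ZMod p`). Let the CSP be UNSATISFIABLE on `H`, `1 ≤ d`, `D ≥ maxDeg · d + (#H - 1)`,
`1, …, d + 1` nonzero in the field, and let the threshold `θ` satisfy
`(d+1)(2d+5) θ ≤ M²` (`M = p^m`). Then for EVERY proof `π` the number of accepting tapes is at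
most
`( ((M² - θ)/M²)ᵀ + 2 Q (d+1) θ / M² + (K D + K (#H - 1) + (N - 1)) / p ) · #tapes`
(`N` the number of families: the seed of the random combination is a root of a nonzero
polynomial of degree `< N` when the combination annihilates a violated constraint),
`Q` the number of oracle reads of the final check: either the oracle is far from passing the
low-degree test (`card_accept_le_of_far`), or it is close to its Rubinfeld–Sudan decoding `g`, a
polynomial of degree `≤ d` on every line, and `card_accept_le_of_close` applies.
[cite: BabaiFortnowLund1991, §5–§7 (soundness)] [cite: AroraBarakCC2009, §8.6.2 and §11.5.2] [cite: RubinfeldSudan1996, §4] -/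
theorem soundness (hC : ¬ C.Satisfiable H) (π : Proof 𝔽 K m C.N) (hd1 : 1 ≤ prm.d)
    (hD : C.maxDeg * prm.d + (H.card - 1) ≤ prm.D)
    (hunit : ∀ i : ℕ, 1 ≤ i → i ≤ prm.d + 1 → (i : 𝔽) ≠ 0) {θ : ℕ}
    (hθ : (prm.d + 1) * (2 * prm.d + 5) * θ ≤ Fintype.card (Fin m → 𝔽) ^ 2) :
    ((univ.filter fun τ : Tape 𝔽 C prm.T => Accept H prm C π τ).card : ℝ) ≤
      ((((Fintype.card (Fin m → 𝔽) * Fintype.card (Fin m → 𝔽) - θ : ℕ) : ℝ) /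
            ((Fintype.card (Fin m → 𝔽) : ℝ) * Fintype.card (Fin m → 𝔽))) ^ prm.T +
        ((2 * Fintype.card C.Qry * (prm.d + 1) * θ : ℕ) : ℝ) / ((Fintype.card (Fin m → 𝔽) : ℝ) * Fintype.card (Fin m → 𝔽)) +
        ((K * prm.D + K * (H.card - 1) + (C.N - 1) : ℕ) : ℝ) / p) * Fintype.card (Tape 𝔽 C prm.T) := by
  set M := Fintype.card (Fin m → 𝔽) with hM
  set N := Fintype.card (Tape 𝔽 C prm.T) with hN
  have hMpos : (0 : ℝ) < M := by exact_mod_cast (Fintype.card_pos : 0 < M)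
  have hppos : (0 : ℝ) < p := by exact_mod_cast (Fact.out : p.Prime).pos
  -- the three terms are nonnegative
  have t1 : (0 : ℝ) ≤ (((M * M - θ : ℕ) : ℝ) / ((M : ℝ) * M)) ^ prm.T := by positivity
  have t2 : (0 : ℝ) ≤ ((2 * Fintype.card C.Qry * (prm.d + 1) * θ : ℕ) : ℝ) / ((M : ℝ) * M) := by positivity
  have t3 : (0 : ℝ) ≤ ((K * prm.D + K * (H.card - 1) + (C.N - 1) : ℕ) : ℝ) / p := by positivity
  by_cases hfar : θ ≤ (fails (diffCoeff prm.d) prm.d π.Y).card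
  · -- far from low degree
    have h := card_accept_le_of_far H prm C π hfar
    rw [← hM, ← hN] at h
    have hMM : (0 : ℝ) < ((M : ℝ) * M) ^ prm.T := by positivity
    have hr : ((univ.filter fun τ : Tape 𝔽 C prm.T => Accept H prm C π τ).card : ℝ) ≤
        (((M * M - θ : ℕ) : ℝ) / ((M : ℝ) * M)) ^ prm.T * N := by
      rw [div_pow, div_mul_eq_mul_div, le_div_iff₀ hMM]
      have h' : (((univ.filter fun τ : Tape 𝔽 C prm.T => Accept H prm C π τ).card * (M * M) ^ prm.T : ℕ) : ℝ) ≤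
          (((M * M - θ) ^ prm.T * N : ℕ) : ℝ) := by exact_mod_cast h
      push_cast at h'
      exact h'
    calc _ ≤ (((M * M - θ : ℕ) : ℝ) / ((M : ℝ) * M)) ^ prm.T * N := hr
      _ ≤ _ := by nlinarith [t2, t3, (Nat.cast_nonneg N : (0 : ℝ) ≤ N)]
  · -- close to the decoding `g`
    rw [not_le] at hfar
    have hpos : 0 < (prm.d + 1) * (2 * prm.d + 5) := by positivity
    have hsmall : (prm.d + 1) * (2 * prm.d + 5) * (fails (diffCoeff prm.d) prm.d π.Y).card < M ^ 2 :=
      lt_of_lt_of_le (Nat.mul_lt_mul_of_pos_left hfar hpos) hθ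
    obtain ⟨g, hgclose, hgpass⟩ := robust (diffCoeff prm.d) prm.d π.Y (diffCoeff_zero_ne prm.d) hunit hsmall
    have hline : LinePoly g prm.d :=
      linePoly_of_fwdDiff_eq_zero g fun x t => by rw [← testSum_diffCoeff]; exact hgpass x t
    have hclose : (univ.filter fun x : Fin m → 𝔽 => π.Y x ≠ g x).card * M ≤ 2 * θ :=
      hgclose.trans (Nat.mul_le_mul_left 2 hfar.le)
    have h := card_accept_le_of_close H prm C hC π hline hd1 hD hunit hclose
    rw [← hM, ← hN] at h
    calc _ ≤ _ := h
      _ ≤ _ := by nlinarith [t1, (Nat.cast_nonneg N : (0 : ℝ) ≤ N)]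

end Soundness

end AlgebraicPCP

end Literature.Computability.Complexity

end
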